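import Summits.MatrixMultiplication.OmegaCensus.DihedralLawModOneRankThree
import Summits.MatrixMultiplication.OmegaCensus.CubeLawParityRank
import HarnessLib

/-!
# No `|A| ≡ 1 (mod 3)` law over the rank-`≥ 3` abelian groups of orders `64`, `136`, `280`: concrete instances

ω-census, family (b3).  Framing: lottery ticket; floor = certified bounds/negative ranges.

Instances of `no_law_card_64/136/280_of_rank_three` (`DihedralLawModOneRankThree.lean`): for
`A ∈ {ℤ₄³, ℤ₂×ℤ₄×ℤ₈, ℤ₂²×ℤ₁₆, ℤ₂²×ℤ₄², ℤ₂⁴×ℤ₄, ℤ₂³×ℤ₈, ℤ₂⁶, ℤ₂³×ℤ₁₇, ℤ₂³×ℤ₃₅}` (written as products of `ZMod`s)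
NO dihedral-like group over `A` (any `c₀`) has a TPP triple attaining `3|S||T||U| + 8 = 8|A|`.  The three parity
homomorphisms are coordinate reductions modulo `2` (`jointlyOnto_prod₃(_prod)`), and the element-order bound
`2·ord(g) < |A|` comes from `e • g = 0` for the exponent `e` (`decide`).  Together with the groups having a cyclic
subgroup of index `≤ 2` (`ℤ₆₄, ℤ₂×ℤ₃₂`; `ℤ₁₃₆, ℤ₂×ℤ₆₈`; `ℤ₂₈₀, ℤ₂×ℤ₁₄₀`, where the law is attained) and the
rank-`2` groups `ℤ₈², ℤ₄×ℤ₁₆` (no law triple by exhaustive enumeration + SAT, `FAMILY-B-ADDENDUM-g5.md` §5), this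
settles the classification 'law ⟺ element of order ≥ |A|/2' at `|A| = 64` (kernel except `ℤ₈², ℤ₄×ℤ₁₆`), `136` and
`280` (kernel).
-/

namespace Summit.MatrixMultiplication.OmegaCensus

open Literature.Combinatorics.Additive Finset

/-! ## Jointly-onto parity maps and exponent bounds -/

section Tools

/-- `M₁ × M₂ × M₃` with ring homomorphisms `Mᵢ →+* ZMod 2`: three additive maps jointly onto `𝔽₂³`. [folklore] -/
theorem jointlyOnto_prod₃ {M₁ M₂ M₃ : Type*} [Ring M₁] [Ring M₂] [Ring M₃]
    (π₁ : M₁ →+* ZMod 2) (π₂ : M₂ →+* ZMod 2) (π₃ : M₃ →+* ZMod 2) :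
    ∀ v : ZMod 2 × ZMod 2 × ZMod 2, ∃ a : M₁ × M₂ × M₃,
      ((π₁.toAddMonoidHom.comp (AddMonoidHom.fst _ _)) a,
        (π₂.toAddMonoidHom.comp ((AddMonoidHom.fst _ _).comp (AddMonoidHom.snd _ _))) a,
        (π₃.toAddMonoidHom.comp ((AddMonoidHom.snd _ _).comp (AddMonoidHom.snd _ _))) a) = v := by
  rintro ⟨v₁, v₂, v₃⟩
  obtain ⟨m₁, h₁⟩ := exists_ringHom_apply_eq π₁ v₁
  obtain ⟨m₂, h₂⟩ := exists_ringHom_apply_eq π₂ v₂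
  obtain ⟨m₃, h₃⟩ := exists_ringHom_apply_eq π₃ v₃
  exact ⟨(m₁, m₂, m₃), by simp [h₁, h₂, h₃]⟩

/-- `M₁ × M₂ × M₃ × B`: three additive maps jointly onto `𝔽₂³`. [folklore] -/
theorem jointlyOnto_prod₃_prod {M₁ M₂ M₃ : Type*} [Ring M₁] [Ring M₂] [Ring M₃] {B : Type*} [AddCommGroup B]
    (π₁ : M₁ →+* ZMod 2) (π₂ : M₂ →+* ZMod 2) (π₃ : M₃ →+* ZMod 2) :
    ∀ v : ZMod 2 × ZMod 2 × ZMod 2, ∃ a : M₁ × M₂ × M₃ × B,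
      ((π₁.toAddMonoidHom.comp (AddMonoidHom.fst _ _)) a,
        (π₂.toAddMonoidHom.comp ((AddMonoidHom.fst _ _).comp (AddMonoidHom.snd _ _))) a,
        (π₃.toAddMonoidHom.comp ((AddMonoidHom.fst _ _).comp ((AddMonoidHom.snd _ _).comp
          (AddMonoidHom.snd _ _)))) a) = v := by
  rintro ⟨v₁, v₂, v₃⟩
  obtain ⟨m₁, h₁⟩ := exists_ringHom_apply_eq π₁ v₁
  obtain ⟨m₂, h₂⟩ := exists_ringHom_apply_eq π₂ v₂
  obtain ⟨m₃, h₃⟩ := exists_ringHom_apply_eq π₃ v₃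
  exact ⟨(m₁, m₂, m₃, 0), by simp [h₁, h₂, h₃]⟩

/-- In `ZMod n`, `e • x = 0` whenever `n ∣ e`. [folklore] -/
theorem zmod_nsmul_eq_zero {n e : ℕ} (h : n ∣ e) (x : ZMod n) : e • x = 0 := by
  obtain ⟨k, rfl⟩ := h
  rw [mul_comm, mul_nsmul, nsmul_eq_mul, ZMod.natCast_self, zero_mul]

/-- If `e • g = 0` for all `g` with `0 < e` and `2e < |A|`, then `2·ord(g) < |A|` for all `g`. [folklore] -/
theorem two_mul_addOrderOf_lt_of_nsmul_eq_zero {A : Type*} [AddCommGroup A] [Fintype A] (e : ℕ) (he : 0 < e)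
    (hexp : ∀ g : A, e • g = 0) (h2e : 2 * e < Fintype.card A) : ∀ g : A, 2 * addOrderOf g < Fintype.card A :=
  fun g => lt_of_le_of_lt (Nat.mul_le_mul_left 2 (addOrderOf_le_of_nsmul_eq_zero he (hexp g))) h2e

end Tools

/-! ## The instances -/

section Instances

variable {G : Type} [Group G] [DecidableEq G]

/-- Shorthand for the conclusion: no TPP triple of a dihedral-like group over `A` attains the `|A| ≡ 1 (mod 3)` law.
[folklore] -/
theorem no_law_of_rank_three_data {A : Type*} [AddCommGroup A] [DecidableEq A] [Fintype A]
    {ρ τ : A → G} {c₀ : A} {S T U : Finset G}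
    (hρρ : ∀ a b, ρ a * ρ b = ρ (a + b)) (hρτ : ∀ a b, ρ a * τ b = τ (b - a))
    (hτρ : ∀ a b, τ a * ρ b = τ (a + b)) (hττ : ∀ a b, τ a * τ b = ρ (c₀ + b - a))
    (hρ : Function.Injective ρ) (hτ : Function.Injective τ) (hne : ∀ a b, ρ a ≠ τ b)
    (hsurj : ∀ g, (∃ a, ρ a = g) ∨ (∃ a, τ a = g))
    (hA : Fintype.card A = 64 ∨ Fintype.card A = 136 ∨ Fintype.card A = 280)
    (ψ₁ ψ₂ ψ₃ : A →+ ZMod 2) (hψ : ∀ v : ZMod 2 × ZMod 2 × ZMod 2, ∃ a, (ψ₁ a, ψ₂ a, ψ₃ a) = v)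
    (hord : ∀ g : A, 2 * addOrderOf g < Fintype.card A) (h : TripleProductProperty S T U) :
    3 * (S.card * T.card * U.card) + 8 ≠ 8 * Fintype.card A := by
  rcases hA with hA | hA | hA
  · exact no_law_card_64_of_rank_three hρρ hρτ hτρ hττ hρ hτ hne hsurj hA ψ₁ ψ₂ ψ₃ hψ hord h
  · exact no_law_card_136_of_rank_three hρρ hρτ hτρ hττ hρ hτ hne hsurj hA ψ₁ ψ₂ ψ₃ hψ hord h
  · exact no_law_card_280_of_rank_three hρρ hρτ hτρ hττ hρ hτ hne hsurj hA ψ₁ ψ₂ ψ₃ hψ hord h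

/-- **`ℤ₄³`**: no dihedral-like group over `ZMod 4 × ZMod 4 × ZMod 4` attains the law. [folklore] -/
theorem no_law_Z4_Z4_Z4 {ρ τ : ZMod 4 × ZMod 4 × ZMod 4 → G} {c₀ : ZMod 4 × ZMod 4 × ZMod 4} {S T U : Finset G}
    (hρρ : ∀ a b, ρ a * ρ b = ρ (a + b)) (hρτ : ∀ a b, ρ a * τ b = τ (b - a))
    (hτρ : ∀ a b, τ a * ρ b = τ (a + b)) (hττ : ∀ a b, τ a * τ b = ρ (c₀ + b - a))
    (hρ : Function.Injective ρ) (hτ : Function.Injective τ) (hne : ∀ a b, ρ a ≠ τ b)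
    (hsurj : ∀ g, (∃ a, ρ a = g) ∨ (∃ a, τ a = g)) (h : TripleProductProperty S T U) :
    3 * (S.card * T.card * U.card) + 8 ≠ 8 * Fintype.card (ZMod 4 × ZMod 4 × ZMod 4) := by
  have hc : Fintype.card (ZMod 4 × ZMod 4 × ZMod 4) = 64 := by simp [Fintype.card_prod, ZMod.card]
  have d4 : 2 ∣ 4 := by norm_num
  refine no_law_of_rank_three_data hρρ hρτ hτρ hττ hρ hτ hne hsurj (Or.inl hc) _ _ _
    (jointlyOnto_prod₃ (ZMod.castHom d4 (ZMod 2)) (ZMod.castHom d4 (ZMod 2)) (ZMod.castHom d4 (ZMod 2)))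
    (two_mul_addOrderOf_lt_of_nsmul_eq_zero 4 (by norm_num) (by decide) (by rw [hc]; norm_num)) h

/-- **`ℤ₂×ℤ₄×ℤ₈`**: no law. [folklore] -/
theorem no_law_Z2_Z4_Z8 {ρ τ : ZMod 2 × ZMod 4 × ZMod 8 → G} {c₀ : ZMod 2 × ZMod 4 × ZMod 8} {S T U : Finset G}
    (hρρ : ∀ a b, ρ a * ρ b = ρ (a + b)) (hρτ : ∀ a b, ρ a * τ b = τ (b - a))
    (hτρ : ∀ a b, τ a * ρ b = τ (a + b)) (hττ : ∀ a b, τ a * τ b = ρ (c₀ + b - a))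
    (hρ : Function.Injective ρ) (hτ : Function.Injective τ) (hne : ∀ a b, ρ a ≠ τ b)
    (hsurj : ∀ g, (∃ a, ρ a = g) ∨ (∃ a, τ a = g)) (h : TripleProductProperty S T U) :
    3 * (S.card * T.card * U.card) + 8 ≠ 8 * Fintype.card (ZMod 2 × ZMod 4 × ZMod 8) := by
  have hc : Fintype.card (ZMod 2 × ZMod 4 × ZMod 8) = 64 := by simp [Fintype.card_prod, ZMod.card]
  refine no_law_of_rank_three_data hρρ hρτ hτρ hττ hρ hτ hne hsurj (Or.inl hc) _ _ _
    (jointlyOnto_prod₃ (RingHom.id (ZMod 2)) (ZMod.castHom (by norm_num : 2 ∣ 4) (ZMod 2))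
      (ZMod.castHom (by norm_num : 2 ∣ 8) (ZMod 2)))
    (two_mul_addOrderOf_lt_of_nsmul_eq_zero 8 (by norm_num) (by decide) (by rw [hc]; norm_num)) h

/-- **`ℤ₂²×ℤ₁₆`**: no law. [folklore] -/
theorem no_law_Z2_Z2_Z16 {ρ τ : ZMod 2 × ZMod 2 × ZMod 16 → G} {c₀ : ZMod 2 × ZMod 2 × ZMod 16}
    {S T U : Finset G}
    (hρρ : ∀ a b, ρ a * ρ b = ρ (a + b)) (hρτ : ∀ a b, ρ a * τ b = τ (b - a))
    (hτρ : ∀ a b, τ a * ρ b = τ (a + b)) (hττ : ∀ a b, τ a * τ b = ρ (c₀ + b - a))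
    (hρ : Function.Injective ρ) (hτ : Function.Injective τ) (hne : ∀ a b, ρ a ≠ τ b)
    (hsurj : ∀ g, (∃ a, ρ a = g) ∨ (∃ a, τ a = g)) (h : TripleProductProperty S T U) :
    3 * (S.card * T.card * U.card) + 8 ≠ 8 * Fintype.card (ZMod 2 × ZMod 2 × ZMod 16) := by
  have hc : Fintype.card (ZMod 2 × ZMod 2 × ZMod 16) = 64 := by simp [Fintype.card_prod, ZMod.card]
  refine no_law_of_rank_three_data hρρ hρτ hτρ hττ hρ hτ hne hsurj (Or.inl hc) _ _ _
    (jointlyOnto_prod₃ (RingHom.id (ZMod 2)) (RingHom.id (ZMod 2)) (ZMod.castHom (by norm_num : 2 ∣ 16) (ZMod 2)))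
    (two_mul_addOrderOf_lt_of_nsmul_eq_zero 16 (by norm_num) (by decide) (by rw [hc]; norm_num)) h

/-- **`ℤ₂²×ℤ₄²`**: no law. [folklore] -/
theorem no_law_Z2_Z2_Z4_Z4 {ρ τ : ZMod 2 × ZMod 2 × ZMod 4 × ZMod 4 → G} {c₀ : ZMod 2 × ZMod 2 × ZMod 4 × ZMod 4}
    {S T U : Finset G}
    (hρρ : ∀ a b, ρ a * ρ b = ρ (a + b)) (hρτ : ∀ a b, ρ a * τ b = τ (b - a))
    (hτρ : ∀ a b, τ a * ρ b = τ (a + b)) (hττ : ∀ a b, τ a * τ b = ρ (c₀ + b - a))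
    (hρ : Function.Injective ρ) (hτ : Function.Injective τ) (hne : ∀ a b, ρ a ≠ τ b)
    (hsurj : ∀ g, (∃ a, ρ a = g) ∨ (∃ a, τ a = g)) (h : TripleProductProperty S T U) :
    3 * (S.card * T.card * U.card) + 8 ≠ 8 * Fintype.card (ZMod 2 × ZMod 2 × ZMod 4 × ZMod 4) := by
  have hc : Fintype.card (ZMod 2 × ZMod 2 × ZMod 4 × ZMod 4) = 64 := by simp [Fintype.card_prod, ZMod.card]
  refine no_law_of_rank_three_data hρρ hρτ hτρ hττ hρ hτ hne hsurj (Or.inl hc) _ _ _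
    (jointlyOnto_prod₃_prod (RingHom.id (ZMod 2)) (RingHom.id (ZMod 2)) (ZMod.castHom (by norm_num : 2 ∣ 4) (ZMod 2)))
    (two_mul_addOrderOf_lt_of_nsmul_eq_zero 4 (by norm_num) (by decide) (by rw [hc]; norm_num)) h

/-- **`ℤ₂⁴×ℤ₄`** (as `ℤ₂³ × (ℤ₂ × ℤ₄)`): no law. [folklore] -/
theorem no_law_Z2_Z2_Z2_Z2_Z4 {ρ τ : ZMod 2 × ZMod 2 × ZMod 2 × (ZMod 2 × ZMod 4) → G}
    {c₀ : ZMod 2 × ZMod 2 × ZMod 2 × (ZMod 2 × ZMod 4)} {S T U : Finset G}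
    (hρρ : ∀ a b, ρ a * ρ b = ρ (a + b)) (hρτ : ∀ a b, ρ a * τ b = τ (b - a))
    (hτρ : ∀ a b, τ a * ρ b = τ (a + b)) (hττ : ∀ a b, τ a * τ b = ρ (c₀ + b - a))
    (hρ : Function.Injective ρ) (hτ : Function.Injective τ) (hne : ∀ a b, ρ a ≠ τ b)
    (hsurj : ∀ g, (∃ a, ρ a = g) ∨ (∃ a, τ a = g)) (h : TripleProductProperty S T U) :
    3 * (S.card * T.card * U.card) + 8 ≠ 8 * Fintype.card (ZMod 2 × ZMod 2 × ZMod 2 × (ZMod 2 × ZMod 4)) := by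
  have hc : Fintype.card (ZMod 2 × ZMod 2 × ZMod 2 × (ZMod 2 × ZMod 4)) = 64 := by
    simp [Fintype.card_prod, ZMod.card]
  refine no_law_of_rank_three_data hρρ hρτ hτρ hττ hρ hτ hne hsurj (Or.inl hc) _ _ _
    (jointlyOnto_prod₃_prod (RingHom.id (ZMod 2)) (RingHom.id (ZMod 2)) (RingHom.id (ZMod 2)))
    (two_mul_addOrderOf_lt_of_nsmul_eq_zero 4 (by norm_num) (by decide) (by rw [hc]; norm_num)) h

/-- **`ℤ₂³×ℤ₈`**: no law. [folklore] -/
theorem no_law_Z2_Z2_Z2_Z8 {ρ τ : ZMod 2 × ZMod 2 × ZMod 2 × ZMod 8 → G} {c₀ : ZMod 2 × ZMod 2 × ZMod 2 × ZMod 8}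
    {S T U : Finset G}
    (hρρ : ∀ a b, ρ a * ρ b = ρ (a + b)) (hρτ : ∀ a b, ρ a * τ b = τ (b - a))
    (hτρ : ∀ a b, τ a * ρ b = τ (a + b)) (hττ : ∀ a b, τ a * τ b = ρ (c₀ + b - a))
    (hρ : Function.Injective ρ) (hτ : Function.Injective τ) (hne : ∀ a b, ρ a ≠ τ b)
    (hsurj : ∀ g, (∃ a, ρ a = g) ∨ (∃ a, τ a = g)) (h : TripleProductProperty S T U) :
    3 * (S.card * T.card * U.card) + 8 ≠ 8 * Fintype.card (ZMod 2 × ZMod 2 × ZMod 2 × ZMod 8) := by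
  have hc : Fintype.card (ZMod 2 × ZMod 2 × ZMod 2 × ZMod 8) = 64 := by simp [Fintype.card_prod, ZMod.card]
  refine no_law_of_rank_three_data hρρ hρτ hτρ hττ hρ hτ hne hsurj (Or.inl hc) _ _ _
    (jointlyOnto_prod₃_prod (RingHom.id (ZMod 2)) (RingHom.id (ZMod 2)) (RingHom.id (ZMod 2)))
    (two_mul_addOrderOf_lt_of_nsmul_eq_zero 8 (by norm_num) (by decide) (by rw [hc]; norm_num)) h

/-- **`ℤ₂⁶`** (as `ℤ₂³ × ℤ₂³`; here the dihedral-like group is abelian anyway): no law. [folklore] -/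
theorem no_law_Z2_pow_six {ρ τ : ZMod 2 × ZMod 2 × ZMod 2 × (ZMod 2 × ZMod 2 × ZMod 2) → G}
    {c₀ : ZMod 2 × ZMod 2 × ZMod 2 × (ZMod 2 × ZMod 2 × ZMod 2)} {S T U : Finset G}
    (hρρ : ∀ a b, ρ a * ρ b = ρ (a + b)) (hρτ : ∀ a b, ρ a * τ b = τ (b - a))
    (hτρ : ∀ a b, τ a * ρ b = τ (a + b)) (hττ : ∀ a b, τ a * τ b = ρ (c₀ + b - a))
    (hρ : Function.Injective ρ) (hτ : Function.Injective τ) (hne : ∀ a b, ρ a ≠ τ b)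
    (hsurj : ∀ g, (∃ a, ρ a = g) ∨ (∃ a, τ a = g)) (h : TripleProductProperty S T U) :
    3 * (S.card * T.card * U.card) + 8 ≠
      8 * Fintype.card (ZMod 2 × ZMod 2 × ZMod 2 × (ZMod 2 × ZMod 2 × ZMod 2)) := by
  have hc : Fintype.card (ZMod 2 × ZMod 2 × ZMod 2 × (ZMod 2 × ZMod 2 × ZMod 2)) = 64 := by
    simp [Fintype.card_prod, ZMod.card]
  refine no_law_of_rank_three_data hρρ hρτ hτρ hττ hρ hτ hne hsurj (Or.inl hc) _ _ _
    (jointlyOnto_prod₃_prod (RingHom.id (ZMod 2)) (RingHom.id (ZMod 2)) (RingHom.id (ZMod 2)))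
    (two_mul_addOrderOf_lt_of_nsmul_eq_zero 2 (by norm_num) (by decide) (by rw [hc]; norm_num)) h

/-- **`ℤ₂³×ℤ₁₇`** (`|A| = 136`): no law. [folklore] -/
theorem no_law_Z2_Z2_Z2_Z17 {ρ τ : ZMod 2 × ZMod 2 × ZMod 2 × ZMod 17 → G}
    {c₀ : ZMod 2 × ZMod 2 × ZMod 2 × ZMod 17} {S T U : Finset G}
    (hρρ : ∀ a b, ρ a * ρ b = ρ (a + b)) (hρτ : ∀ a b, ρ a * τ b = τ (b - a))
    (hτρ : ∀ a b, τ a * ρ b = τ (a + b)) (hττ : ∀ a b, τ a * τ b = ρ (c₀ + b - a))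
    (hρ : Function.Injective ρ) (hτ : Function.Injective τ) (hne : ∀ a b, ρ a ≠ τ b)
    (hsurj : ∀ g, (∃ a, ρ a = g) ∨ (∃ a, τ a = g)) (h : TripleProductProperty S T U) :
    3 * (S.card * T.card * U.card) + 8 ≠ 8 * Fintype.card (ZMod 2 × ZMod 2 × ZMod 2 × ZMod 17) := by
  have hc : Fintype.card (ZMod 2 × ZMod 2 × ZMod 2 × ZMod 17) = 136 := by simp [Fintype.card_prod, ZMod.card]
  refine no_law_of_rank_three_data hρρ hρτ hτρ hττ hρ hτ hne hsurj (Or.inr (Or.inl hc)) _ _ _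
    (jointlyOnto_prod₃_prod (RingHom.id (ZMod 2)) (RingHom.id (ZMod 2)) (RingHom.id (ZMod 2)))
    (two_mul_addOrderOf_lt_of_nsmul_eq_zero 34 (by norm_num)
      (by rintro ⟨a, b, c, x⟩
          simp only [Prod.smul_mk, Prod.mk_eq_zero]
          exact ⟨zmod_nsmul_eq_zero (by norm_num) a, zmod_nsmul_eq_zero (by norm_num) b,
            zmod_nsmul_eq_zero (by norm_num) c, zmod_nsmul_eq_zero (by norm_num) x⟩)
      (by rw [hc]; norm_num)) h

/-- **`ℤ₂³×ℤ₃₅`** (`|A| = 280`): no law. [folklore] -/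
theorem no_law_Z2_Z2_Z2_Z35 {ρ τ : ZMod 2 × ZMod 2 × ZMod 2 × ZMod 35 → G}
    {c₀ : ZMod 2 × ZMod 2 × ZMod 2 × ZMod 35} {S T U : Finset G}
    (hρρ : ∀ a b, ρ a * ρ b = ρ (a + b)) (hρτ : ∀ a b, ρ a * τ b = τ (b - a))
    (hτρ : ∀ a b, τ a * ρ b = τ (a + b)) (hττ : ∀ a b, τ a * τ b = ρ (c₀ + b - a))
    (hρ : Function.Injective ρ) (hτ : Function.Injective τ) (hne : ∀ a b, ρ a ≠ τ b)
    (hsurj : ∀ g, (∃ a, ρ a = g) ∨ (∃ a, τ a = g)) (h : TripleProductProperty S T U) :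
    3 * (S.card * T.card * U.card) + 8 ≠ 8 * Fintype.card (ZMod 2 × ZMod 2 × ZMod 2 × ZMod 35) := by
  have hc : Fintype.card (ZMod 2 × ZMod 2 × ZMod 2 × ZMod 35) = 280 := by simp [Fintype.card_prod, ZMod.card]
  refine no_law_of_rank_three_data hρρ hρτ hτρ hττ hρ hτ hne hsurj (Or.inr (Or.inr hc)) _ _ _
    (jointlyOnto_prod₃_prod (RingHom.id (ZMod 2)) (RingHom.id (ZMod 2)) (RingHom.id (ZMod 2)))
    (two_mul_addOrderOf_lt_of_nsmul_eq_zero 70 (by norm_num)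
      (by rintro ⟨a, b, c, x⟩
          simp only [Prod.smul_mk, Prod.mk_eq_zero]
          exact ⟨zmod_nsmul_eq_zero (by norm_num) a, zmod_nsmul_eq_zero (by norm_num) b,
            zmod_nsmul_eq_zero (by norm_num) c, zmod_nsmul_eq_zero (by norm_num) x⟩)
      (by rw [hc]; norm_num)) h

end Instances

end Summit.MatrixMultiplication.OmegaCensus
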